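import Literature.Combinatorics.SimpleGraph.GraphRiemannRoch
import Mathlib.Combinatorics.SimpleGraph.CycleGraph
import HarnessLib

/-!
# Riemann–Roch on graphs: maximal unwinnable divisors, trees (`g = 0`) and cycles (`g = 1`)
# (Baker–Norine 2007, Theorems 1.9, 1.12, 3.3 — worked consequences)

Source (held, read at the page; statements VERBATIM). M. Baker, S. Norine, *Riemann–Roch and
Abel–Jacobi theory on a finite graph*, Adv. Math. 215 (2007) 766–788 [BakerNorine2007] (held text
`paper:doi-10-1016-j-aim-2007-04-012`). Theorem 3.3 (proof): «If `D(v₀) ≥ 0` then we have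
`D ≥ 0` and (N1) holds. If, on the other hand, `D(v₀) ≤ −1` then `D ≤ ν_P` and (N2) holds.»
Theorem 1.9: «1. If `N ≥ g`, then there is always a winning strategy. 2. If `N ≤ g − 1`, then
there is always an initial configuration for which no winning strategy exists.» Theorem 1.12:
«`r(D) − r(K − D) = deg(D) + 1 − g`.» §1.4: «`g = |E(G)| − |V(G)| + 1` […] the genus of `G`,
which is the number of linearly independent cycles of `G`»; Remark 4.8 (ii): «there is a unique
2-edge-connected graph of genus 0 (the graph with one vertex and no edges) […] a 2-edge-connected
graph of genus 1 is isomorphic to a cycle of length `n ≥ 2`». §2: «if `deg(D) = 0` then `r(D) = 0`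
if `D ∼ 0` and `r(D) = −1` otherwise.»

## What is formalised (vocabulary of `GraphDivisors` … `GraphRiemannRoch`) — validation of the
## theory on the two extreme families, and the maximality of the `ν_P`

* **maximal unwinnable divisors**: `exists_linEquiv_le_orderDivisor` (every divisor with
  `|D| = ∅` is, up to `∼`, dominated by some `ν_P` — Theorem 3.3's (N2)), and the `ν_P` are
  maximal with `|ν_P| = ∅`: `winnable_orderDivisor_add` (adding any non-zero effective divisor to
  `ν_P` gives a winning position, by Theorem 1.9 (1) in degree `g`);
* **trees** (`g = 0`): `genus_eq_zero_iff_isTree`, `winnable_iff_sum_nonneg_of_isTree` (a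
  configuration on a tree is winnable iff its degree is `≥ 0`), `rank_eq_sum_of_isTree`
  (`r(D) = deg D` for `deg D ≥ −1`), `linEquiv_of_isTree` (divisors of equal degree are linearly
  equivalent — `Jac` of a tree is trivial);
* **cycles** (`g = 1`): `genus_cycleGraph` (`g(C_N) = 1`), `canonicalDivisor_cycleGraph`
  (`K = 0`), `rank_cycleGraph_of_pos` (`r(D) = deg D − 1` for `deg D ≥ 1`),
  `winnable_cycleGraph_iff` (for `deg D ≥ 1` every configuration wins; in degree `0` exactly the
  principal class).

Theorems only; no `sorry`; no named facts.
-/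

open Finset SimpleGraph Matrix
open Literature.Combinatorics.SimpleGraph.ChipFiring

namespace Literature.Combinatorics.SimpleGraph.BakerNorine

variable {V : Type*} [Fintype V] [DecidableEq V] {G : SimpleGraph V} [DecidableRel G.Adj]

/-! ### §1 The `ν_P` are the maximal unwinnable divisors -/

section Maximal

/-- «If […] `D(v₀) ≤ −1` then `D ≤ ν_P` and (N2) holds»: every divisor with `|D| = ∅` is linearly
equivalent to a divisor dominated by some `ν_P`. [cite: BakerNorine2007, Theorem 3.3 (proof)] -/
theorem exists_linEquiv_le_orderDivisor (hG : G.Connected) {D : V → ℤ} (hD : ¬Winnable G D) :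
    ∃ D' : V → ℤ, ∃ ρ : V → ℕ, Function.Injective ρ ∧ LinEquiv G D D' ∧ D' ≤ orderDivisor G ρ := by
  rcases winnable_or_exists_winnable_orderDivisor_sub hG D with h | ⟨ρ, hρ, E, hE, hνE⟩
  · exact absurd h hD
  · refine ⟨orderDivisor G ρ - E, ρ, hρ, ?_, fun v => ?_⟩
    · -- `ν − D ∼ E` gives `D ∼ ν − E`
      have := hνE.sub_left (orderDivisor G ρ)
      rwa [sub_sub_cancel] at this
    · have h0 : (0 : ℤ) ≤ E v := hE v
      rw [Pi.sub_apply]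
      linarith

/-- The `ν_P` are maximal unwinnable: adding a non-zero effective divisor to `ν_P` yields a
winning position (its degree is at least `g`, Theorem 1.9 (1)).
[cite: BakerNorine2007, Theorem 1.9 (1) with §3.2 («`deg(ν_P) = g − 1`»)] -/
theorem winnable_orderDivisor_add (hG : G.Connected) {ρ : V → ℕ} (hρ : Function.Injective ρ)
    {E : V → ℤ} (hE : 0 ≤ E) (hE0 : E ≠ 0) : Winnable G (orderDivisor G ρ + E) := by
  refine winnable_of_genus_le_sum hG ?_
  simp only [Pi.add_apply, Finset.sum_add_distrib, sum_orderDivisor G hρ]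
  -- `deg E ≥ 1`
  obtain ⟨u, hu⟩ : ∃ u, E u ≠ 0 := by
    by_contra hcon
    push Not at hcon
    exact hE0 (funext hcon)
  have hu' : 0 < E u := lt_of_le_of_ne (hE u) (Ne.symm hu)
  have : E u ≤ ∑ v, E v := Finset.single_le_sum (fun v _ => hE v) (mem_univ u)
  omega

/-- In particular `ν_P + (v)` is a winning position for every vertex `v`.
[cite: BakerNorine2007, Theorem 1.9 (1) with §3.2] -/
theorem winnable_orderDivisor_add_single (hG : G.Connected) {ρ : V → ℕ} (hρ : Function.Injective ρ)
    (v : V) : Winnable G (orderDivisor G ρ + Pi.single v 1) := by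
  refine winnable_orderDivisor_add hG hρ (fun w => ?_) fun h => ?_
  · rw [Pi.zero_apply]
    by_cases hw : w = v
    · rw [hw, Pi.single_eq_same]
      exact zero_le_one
    · rw [Pi.single_eq_of_ne hw]
  · have := congrFun h v
    rw [Pi.single_eq_same] at this
    exact one_ne_zero this

end Maximal

/-! ### §2 Trees: genus `0` -/

section Trees

omit [DecidableEq V] in
/-- A connected graph has genus `0` iff it is a tree («there is a unique 2-edge-connected graph of
genus 0», Remark 4.8 (ii); `g` «is the number of linearly independent cycles»).
[cite: BakerNorine2007, §1.4 and Remark 4.8 (ii)] -/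
theorem genus_eq_zero_iff_isTree (hG : G.Connected) : genus G = 0 ↔ G.IsTree := by
  rw [SimpleGraph.isTree_iff_connected_and_card, Nat.card_eq_fintype_card, Nat.card_eq_fintype_card,
    ← edgeFinset_card, genus_eq]
  constructor
  · intro h
    exact ⟨hG, by omega⟩
  · rintro ⟨-, h⟩
    omega

/-- On a tree, a configuration has a winning strategy iff its degree is non-negative
(Theorem 1.9 (1) with `g = 0`, and `|D| = ∅` for `deg D < 0`).
[cite: BakerNorine2007, Theorem 1.9 (1) and §2] -/
theorem winnable_iff_sum_nonneg_of_isTree (hT : G.IsTree) {D : V → ℤ} :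
    Winnable G D ↔ 0 ≤ ∑ v, D v := by
  have hg := (genus_eq_zero_iff_isTree hT.connected).2 hT
  refine ⟨Winnable.sum_nonneg, fun h => winnable_of_genus_le_sum hT.connected ?_⟩
  rw [hg]
  exact h

/-- On a tree `r(D) = deg D` as soon as `deg D ≥ −1` (Theorem 1.12 with `g = 0`, `K − D` of
negative degree). [cite: BakerNorine2007, Theorem 1.12] -/
theorem rank_eq_sum_of_isTree (hT : G.IsTree) {D : V → ℤ} (h : -1 ≤ ∑ v, D v) :
    rank G D = ∑ v, D v := by
  have hg := (genus_eq_zero_iff_isTree hT.connected).2 hT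
  have := rank_eq_of_lt_sum hT.connected (D := D) (by rw [hg]; omega)
  rw [this, hg, sub_zero]

/-- On a tree any two divisors of the same degree are linearly equivalent (the Jacobian of a tree
is trivial: «if `deg(D) = 0` then `r(D) = 0` if `D ∼ 0`», and here `r = 0` in degree `0`).
[cite: BakerNorine2007, §2 and Theorem 1.9 (1)] -/
theorem linEquiv_of_isTree (hT : G.IsTree) {D D' : V → ℤ} (h : ∑ v, D v = ∑ v, D' v) :
    LinEquiv G D D' := by
  have h0 : ∑ v, (D - D') v = 0 := by
    simp only [Pi.sub_apply, Finset.sum_sub_distrib, h, sub_self]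
  have hW := (winnable_iff_sum_nonneg_of_isTree hT).2 h0.ge
  have hL := (winnable_iff_linEquiv_zero_of_sum_eq_zero G h0).1 hW
  rw [linEquiv_iff, sub_zero] at hL
  exact hL

end Trees

/-! ### §3 Cycles: genus `1` -/

section Cycles

variable {n : ℕ}

/-- `g(C_N) = 1` for the cycle `C_N`, `N ≥ 3` («a 2-edge-connected graph of genus 1 is isomorphic
to a cycle»). [cite: BakerNorine2007, §1.4 and Remark 4.8 (ii)] -/
theorem genus_cycleGraph : genus (cycleGraph (n + 3)) = 1 := by
  have h := (cycleGraph (n + 3)).sum_degrees_eq_twice_card_edges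
  simp only [SimpleGraph.cycleGraph_degree_three_le, Finset.sum_const, Finset.card_univ,
    Fintype.card_fin, smul_eq_mul] at h
  rw [genus_eq, Fintype.card_fin]
  omega

/-- On a cycle the canonical divisor vanishes: `K = 0` (every vertex has degree `2`).
[cite: BakerNorine2007, §1.6 (1.11)] -/
theorem canonicalDivisor_cycleGraph : canonicalDivisor (cycleGraph (n + 3)) = 0 := by
  funext v
  rw [canonicalDivisor_apply, SimpleGraph.cycleGraph_degree_three_le]
  rfl

/-- On a cycle `r(D) = deg D − 1` for `deg D ≥ 1` (Theorem 1.12 with `g = 1`, `K = 0`).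
[cite: BakerNorine2007, Theorem 1.12] -/
theorem rank_cycleGraph_of_pos {D : Fin (n + 3) → ℤ} (h : 0 < ∑ v, D v) :
    rank (cycleGraph (n + 3)) D = ∑ v, D v - 1 := by
  have := rank_eq_of_lt_sum (SimpleGraph.cycleGraph_connected) (D := D)
    (by rw [genus_cycleGraph]; linarith)
  rw [this, genus_cycleGraph]

/-- On a cycle every configuration of positive degree wins, none of negative degree does, and in
degree `0` exactly the principal class wins (Theorem 1.9 with `g = 1`; §2).
[cite: BakerNorine2007, Theorem 1.9 and §2] -/
theorem winnable_cycleGraph_iff {D : Fin (n + 3) → ℤ} :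
    Winnable (cycleGraph (n + 3)) D ↔
      0 < ∑ v, D v ∨ (∑ v, D v = 0 ∧ LinEquiv (cycleGraph (n + 3)) D 0) := by
  constructor
  · intro hW
    have h0 := hW.sum_nonneg
    rcases h0.lt_or_eq with h | h
    · exact Or.inl h
    · exact Or.inr ⟨h.symm, (winnable_iff_linEquiv_zero_of_sum_eq_zero _ h.symm).1 hW⟩
  · rintro (h | ⟨h0, h⟩)
    · exact winnable_of_genus_le_sum SimpleGraph.cycleGraph_connected
        (by rw [genus_cycleGraph]; linarith)
    · exact (winnable_iff_linEquiv_zero_of_sum_eq_zero _ h0).2 h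

end Cycles

end Literature.Combinatorics.SimpleGraph.BakerNorine
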